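import Mathlib
import HarnessLib
import Summits.NavierStokesRegularity.NavierStokesRegularity.Theorems.TaylorModelRungThreeCertificateReadoutVStepWinP

/-!
# Crux K1b-DR (stmt-NavierStokesRegularity-23954), line `taylor-model` — v3 read-outs, K-SIDE part 4b-WP: per-clause soundness of the
# Poincaré-corrected windowed read-out step `readoutStepWinP` (ns-tm-g4 g6)

One-liners from `readoutStepWinP_ok` (the tests shared with `readoutStepWin` reuse its kernels' soundness theorems):
`readoutStepWinP_win` (window order), `_R5` (nodes), `_R7` (fat `Y1`), `_R5w1` (level-1 window ends), `_R8` (on `Z1`), `_R11` (on `Z1`);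
and the CENTRE-ONLY in-step box: `IntervalD.mem_zero_mulR` (`0 ∈ I·J` whenever `0 ∈ J`), `CertTables.inStepY_point_spec` — for the
point hull `pointBoxA x`, `tp_c + r_c ∈ inStepY[c]` for `tp ∈ TP`, `|r_c| ≤ J_c·u^(p+1)` (no kernel needed: the mean-value term is
`[Min]·([x,x] ⊖ x) ∋ 0`), hence `readoutStepWin_Zc` — the states `TP(u) + r` of the centre polynomial lie in `Zl U uR (pointBoxA x)`
(the boxes `Z0c`, `Z0ca`, `Z0cb`).

HONEST FRAMING: kernel bookkeeping for the MODEL certificate №23954 (rung TL-M3); nothing here is a statement about the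
Navier–Stokes equations.
-/

-- the sub-problem namespace repeats the summit name by design (D-0017)
set_option linter.dupNamespace false

namespace Summit.NavierStokesRegularity.NavierStokesRegularity.Theorems.TaylorModelCert

open scoped BigOperators
open Set
open Literature.Analysis.FluidPDE.TaoCascade Literature.Analysis.FluidPDE.TaoCascade.TaylorChain
open Summit.NavierStokesRegularity.NavierStokesRegularity.Theorems.TaylorModelReadout (taylorJet varJet)

namespace IntervalD

/-- `0 ∈ I·J` (Moore product, rounded) whenever `0 ∈ J` — no membership in `I` needed. [folklore] -/
theorem mem_zero_mulR (prec : ℕ) (I : IntervalD) {J : IntervalD} (hJ : mem 0 J) : mem 0 (mulR prec I J) := by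
  apply mem_roundOut
  obtain ⟨hlo, hhi⟩ := hJ
  constructor
  · show (mul I J).lo.toReal ≤ 0
    simp only [mul, Dyad.toReal_min, Dyad.toReal_mul]
    by_cases h : 0 ≤ I.lo.toReal
    · exact le_trans (min_le_left _ _) (le_trans (min_le_left _ _) (mul_nonpos_of_nonneg_of_nonpos h hlo))
    · rw [not_le] at h
      exact le_trans (min_le_left _ _) (le_trans (min_le_right _ _) (mul_nonpos_of_nonpos_of_nonneg h.le hhi))
  · show 0 ≤ (mul I J).hi.toReal
    simp only [mul, Dyad.toReal_max, Dyad.toReal_mul]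
    by_cases h : 0 ≤ I.lo.toReal
    · exact le_trans (le_trans (mul_nonneg h hhi) (le_max_right _ _)) (le_max_left _ _)
    · rw [not_le] at h
      exact le_trans (le_trans (mul_nonneg_of_nonpos_of_nonpos h.le hlo) (le_max_left _ _)) (le_max_left _ _)

end IntervalD

namespace CertTables

variable {K : Type} [Field K] {φ : K →+* ℝ} (T : CertTables K)

omit [Field K] in
/-- **The in-step box over the POINT hull** `pointBoxA x`: `tp_c + r_c ∈ inStepY[c]` for `tp ∈ TP`, `|r_c| ≤ J_c·u^(p+1)`,
`0 ≤ u ≤ uR` — the mean-value term `[Min]·([x,x] ⊖ x)` contains `0` for ANY kernel box `Min`. [folklore] -/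
theorem inStepY_point_spec (prec p : ℕ) {TP : Array IntervalD} {tp : ℕ → ℝ} (htp : ∀ c < T.n, IntervalD.mem (tp c) (IntervalD.aget TP c))
    {J : Array Dyad} {uR : Dyad} {u : ℝ} (hu0 : 0 ≤ u) (huR : u ≤ uR.toReal) {rr : ℕ → ℝ}
    (hr : ∀ c < T.n, |rr c| ≤ (dget J c).toReal * u ^ (p + 1)) (Min : Array (Array IntervalD)) (x : Array Dyad) {c : ℕ} (hc : c < T.n) :
    IntervalD.mem (tp c + rr c) (IntervalD.aget (T.inStepY prec p TP J uR Min (IntervalD.pointBoxA T.n x) x) c) := by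
  have hU : IntervalD.mem u ⟨Dyad.ofInt 0, uR⟩ := IntervalD.mem_zeroTo hu0 huR
  have hJ : IntervalD.mem ((dget J c).toReal * u ^ (p + 1))
      (IntervalD.mulR prec (IntervalD.ofDyad (dget J c)) (IntervalD.powR prec ⟨Dyad.ofInt 0, uR⟩ (p + 1))) :=
    IntervalD.mem_mulR prec (IntervalD.mem_ofDyad _) (IntervalD.mem_powR prec hU _)
  have hrr : IntervalD.mem (rr c)
      (IntervalD.symBox (IntervalD.mulR prec (IntervalD.ofDyad (dget J c)) (IntervalD.powR prec ⟨Dyad.ofInt 0, uR⟩ (p + 1))).hi) :=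
    IntervalD.mem_symBox (le_trans (hr c hc) hJ.2)
  -- the mean-value term contains 0
  have hD : ∀ c' < T.n, IntervalD.mem 0 (IntervalD.aget (IntervalD.subIVD T.n prec (IntervalD.pointBoxA T.n x) x) c') := by
    intro c' hc'
    have h := IntervalD.mem_subIVD prec x (fun c'' hc'' => IntervalD.mem_pointBoxA (n := T.n) x hc'') hc'
    simpa using h
  have hMV : IntervalD.mem 0 (IntervalD.aget (IntervalD.mulIV T.n prec Min (IntervalD.subIVD T.n prec (IntervalD.pointBoxA T.n x) x)) c) := by
    unfold IntervalD.mulIV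
    rw [IntervalD.aget_ofFn _ hc]
    have h := IntervalD.mem_rangeSumR prec (f := fun c' => IntervalD.mulR prec (imget Min c c')
      (IntervalD.aget (IntervalD.subIVD T.n prec (IntervalD.pointBoxA T.n x) x) c')) (g := fun _ => (0:ℝ)) T.n
      (fun c' hc' => IntervalD.mem_zero_mulR prec _ (hD c' hc'))
    simpa using h
  unfold inStepY
  rw [IntervalD.aget_ofFn _ hc]
  have h := IntervalD.mem_addR prec (IntervalD.mem_addR prec (htp c hc) hrr) hMV
  simpa using h

/-- **The centre polynomial's states lie in the point-hull box**: for `u ∈ U`, `0 ≤ u ≤ uR` and a remainder `r` with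
`|wv r c| ≤ J_c·u^(p+1)`, the window values of `TP(u) + r` lie in `Zl U uR (pointBoxA x)`. [folklore] -/
theorem readoutStepWin_Zc (rw : ROInWin) (hco : T.CoefOK φ) (hcB : CoefBoxOK φ T rw.base.coefB) (hmt : rw.base.mt = T.monosTable rw.base.coefB)
    {U : IntervalD} {uR : Dyad} {u : ℝ} (huU : IntervalD.mem u U) (hu0 : 0 ≤ u) (huR : u ≤ uR.toReal)
    {r : Fin 4 → ℤ → ℝ} (hr : ∀ c < T.n, |T.wv r c| ≤ vre rw.base.J c * u ^ (rw.base.p + 1)) :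
    MemVec T.n (fun c => (∑ n ∈ Finset.range (rw.base.p + 1),
          taylorJet (T.toCertData φ).Qb (T.vecF (vre rw.base.x)) n (T.wi c) (T.wk c) * u ^ n) + T.wv r c)
      (rw.Zl T U uR (IntervalD.pointBoxA T.n rw.base.x)) := by
  intro c hc
  have htp : ∀ c < T.n, IntervalD.mem (∑ n ∈ Finset.range (rw.base.p + 1),
      taylorJet (T.toCertData φ).Qb (T.vecF (vre rw.base.x)) n (T.wi c) (T.wk c) * u ^ n) (IntervalD.aget (rw.TPw T U) c) := by
    intro c hc
    have hk := T.InW_wk hc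
    have := T.coreTP_spec hco hcB hmt rw.base.prec rw.base.p rw.base.x huU (T.wi c) hk.1 hk.2
    rwa [T.idx_wi_wk hc] at this
  exact T.inStepY_point_spec rw.base.prec rw.base.p htp hu0 huR hr (rw.MinW T) rw.base.x hc

variable (rp : ROInWinP)

omit [Field K] in
/-- **Window order** from the P step. [folklore] -/
theorem readoutStepWinP_win (hok : (T.readoutStepWinP rp).ok = true) :
    0 ≤ rp.win.u1lo.toReal ∧ rp.win.u1lo.toReal ≤ rp.win.u0lo.toReal ∧ rp.win.u0lo.toReal ≤ rp.win.u0hi.toReal ∧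
      rp.win.u0hi.toReal ≤ rp.win.u1hi.toReal ∧ rp.win.u1hi.toReal ≤ rp.win.base.h.toReal :=
  winOK_sound (T.readoutStepWinP_ok rp hok).1

/-- **(R5)** (at the nodes) from the P step. [folklore] -/
theorem readoutStepWinP_R5 (hok : (T.readoutStepWinP rp).ok = true) {wσ : List K}
    (hW : ∀ c < T.n, IntervalD.mem (φ (vget wσ c)) (IntervalD.aget rp.win.base.Wσ c)) {lev : ℝ} (hL : IntervalD.mem lev rp.win.base.LB) :
    (∀ y : Fin 4 → ℤ → ℝ, MemVec T.n (T.wv y) rp.win.base.H1 → T.covR φ wσ y < lev) ∧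
    (∀ y : Fin 4 → ℤ → ℝ, MemVec T.n (T.wv y) rp.win.base.Ha1 → lev < T.covR φ wσ y) :=
  T.testR5_sound hW hL (T.readoutStepWinP_ok rp hok).2.1

/-- **(R7)** on the fat level-1 box from the P step. [folklore] -/
theorem readoutStepWinP_R7 (hco : T.CoefOK φ) (hcB : CoefBoxOK φ T rp.win.base.coefB) (hmt : rp.win.base.mt = T.monosTable rp.win.base.coefB)
    (hok : (T.readoutStepWinP rp).ok = true) {wσ : List K} (hW : ∀ c < T.n, IntervalD.mem (φ (vget wσ c)) (IntervalD.aget rp.win.base.Wσ c))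
    {γ : ℝ} (hG : IntervalD.mem γ rp.win.base.GB) :
    ∀ y : Fin 4 → ℤ → ℝ, MemVec T.n (T.wv y) (rp.win.base.Y1 T) → γ ≤ T.covR φ wσ ((T.toCertData φ).Qb y y) :=
  T.testR7_sound hco hcB hmt hW hG (T.size_Y1 rp.win.base) (T.readoutStepWinP_ok rp hok).2.2.1

/-- **Level-1 window-end section tests** from the P step. [folklore] -/
theorem readoutStepWinP_R5w1 (hok : (T.readoutStepWinP rp).ok = true) {wσ : List K}
    (hW : ∀ c < T.n, IntervalD.mem (φ (vget wσ c)) (IntervalD.aget rp.win.base.Wσ c)) {lev : ℝ} (hL : IntervalD.mem lev rp.win.base.LB) :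
    (∀ y : Fin 4 → ℤ → ℝ, MemVec T.n (T.wv y) (rp.win.Z1a T) → T.covR φ wσ y < lev) ∧
    (∀ y : Fin 4 → ℤ → ℝ, MemVec T.n (T.wv y) (rp.win.Z1b T) → lev < T.covR φ wσ y) :=
  T.testR5_sound hW hL (T.readoutStepWinP_ok rp hok).2.2.2.1

omit [Field K] in
/-- **(R8)** on `Z1` from the P step. [folklore] -/
theorem readoutStepWinP_R8 (hok : (T.readoutStepWinP rp).ok = true) {as aK R : ℝ} (has : IntervalD.mem as rp.win.base.ASB)
    (haK : IntervalD.mem aK rp.win.base.AK) (hR : rp.win.base.rlo.toReal ≤ R) :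
    ∀ y : Fin 4 → ℤ → ℝ, MemVec T.n (T.wv y) (rp.win.Z1 T) → as ≤ |y T.i₀ 1| ∧ ∀ i, |y i (-T.Kb)| + aK ≤ R :=
  T.testR8_sound (T.readoutStepWinP_ok rp hok).2.2.2.2.2.1 has haK hR

/-- **(R11)** on `Z1` from the P step (hypotheses as `readoutStepWin_R11`). [folklore] -/
theorem readoutStepWinP_R11 (hco : T.CoefOK φ) (hcB : CoefBoxOK φ T rp.win.base.coefB) (hmt : rp.win.base.mt = T.monosTable rp.win.base.coefB)
    (hok : (T.readoutStepWinP rp).ok = true)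
    {w : ℕ → List K} (hW : ∀ l < rp.win.base.nF, ∀ a < T.n, IntervalD.mem (φ (vget (w l) a)) (IntervalD.aget (IntervalD.lget rp.win.base.WJ l) a))
    {g : ℕ → ℕ → ℝ} (hG : ∀ l < rp.win.base.nF, ∀ c < T.n, IntervalD.mem (g l c) (IntervalD.aget (IntervalD.lget rp.win.base.G l) c))
    {rP β : ℕ → ℝ} (hrP : ∀ l < rp.win.base.nF, IntervalD.mem (rP l) (IntervalD.aget rp.win.base.rPB l))
    (hβ : ∀ l < rp.win.base.nF, IntervalD.mem (β l) (IntervalD.aget rp.win.base.βB l))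
    {Lv : ℝ} (hLv : IntervalD.mem Lv rp.win.base.LvB) {v : Fin 4 → ℝ} (hv : ∀ i, |v i| ≤ rp.win.base.tv.toReal)
    {y : Fin 4 → ℤ → ℝ} (hy : MemVec T.n (T.wv y) (rp.win.Z1 T))
    {wσ : List K} (hWσ : ∀ b < T.n, IntervalD.mem (φ (vget wσ b)) (IntervalD.aget rp.win.base.Wσ b))
    {vm : ℕ → ℕ → ℝ} (hV : MemMat T.n vm (rp.win.VBw T))
    {ζ : ℕ → ℝ} (hρ : ∀ c < T.n, |ζ c| ≤ (dget rp.win.base.ρ c).toReal)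
    (hface : ∀ l < rp.win.base.nF, |∑ c ∈ Finset.range T.n, g l c * ζ c| ≤ rP l)
    {z : Fin 4 → ℤ → ℝ} (hz : ∀ b < T.n, T.wv z b = ∑ c ∈ Finset.range T.n, vm b c * ζ c)
    {l : ℕ} (hl : l < rp.win.base.nF) :
    |∑ a ∈ Finset.range T.n, φ (vget (w l) a) * T.wv (T.landDF Lv y v (T.secCorrF φ wσ ((T.toCertData φ).Qb y y) z)) a| ≤ β l := by
  obtain ⟨_, _, _, _, _, _, _, h11⟩ := T.readoutStepWinP_ok rp hok
  have hFE : IntervalD.IsFieldEnclosureA T.wv (qBf (T.toCertData φ)) T.n (T.qBboxMA rp.win.base.coefB rp.win.base.prec rp.win.base.mt) := by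
    rw [hmt]; exact T.isFieldEnclosureA_qBboxMA hco hcB rp.win.base.prec
  have hq : MemVec T.n (T.wv ((T.toCertData φ).Qb y y)) (rp.win.Fw T) := by
    intro c hc
    rw [T.Qb_diag_eq_qBf]
    exact hFE _ _ y y (T.size_Z1 rp.win) (T.size_Z1 rp.win) hy hy c hc
  exact T.testR11_sound h11 hW hG hrP hβ hLv hv hy hWσ hq hV hρ hface hz hl

end CertTables

end Summit.NavierStokesRegularity.NavierStokesRegularity.Theorems.TaylorModelCert
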